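import Literature.NumberTheory.LFunctions.MoebiusHarmonicSumBound
import HarnessLib

/-!
# `∑_{n ≤ u} μ(n) log(u/n)/n → 1` (the one-dimensional input for Green–Tao's Proposition 9.5)

Trunk T-SIEVE / T-ANT. Everything in this file is PROVED.

This is the first brick of an elementary proof of the Goldston–Yıldırım linear forms estimate,
Green–Tao, Ann. of Math. 167 (2008), Proposition 9.5 (`Literature.NumberTheory.Sieve.GreenTao2008.GoldstonYildirimLinearForms`,
file `GreenTao2008Majorant.lean`), replacing the contour integration of §10 and Appendix A of the
source by Selberg's diagonalisation of the quadratic form `∑ μ(d)μ(d') log(R/d) log(R/d')/[d,d']`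
(S. W. Graham, *An asymptotic estimate related to Selberg's sieve*, J. Number Theory 10 (1978)).
After diagonalisation the only analytic input is the behaviour of the logarithmic Riesz mean

  `M₁(u) = ∑_{n ≤ u} μ(n) log(u/n) / n`,

namely `M₁(u) → 1` (a statement of prime-number-theorem depth) and `sup_u |M₁(u)| < ∞`. We prove:

* `moebiusLogSum_eq_integral`: `M₁(u) = ∫_1^u m(t) dt/t` with `m(t) = ∑_{n ≤ t} μ(n)/n`
  (Abel summation);
* `integral_moebiusHarmonic_div_eq_one`: `∫_1^∞ m(t) dt/t = 1` — for `δ > 0`,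
  `δ ∫_1^∞ m(t) t^{-1-δ} dt = L(μ/id, δ) = 1/ζ(1+δ)` (Mathlib's `LSeries_eq_mul_integral`), so
  `∫_1^∞ m(t) t^{-1-δ} dt = 1/(δ ζ(1+δ)) → 1` (the simple pole of `ζ`, `riemannZeta_residue_one`),
  while the integrals tend to `∫_1^∞ m(t) dt/t` by dominated convergence, the dominating function
  coming from the tree's `|m(t)| ≤ C exp(-c√log t)`
  (`Literature.NumberTheory.LFunctions.abs_sum_moebius_div_le_exp_neg_sqrt_log`, de la Vallée-Poussin–Landau);
* `exists_abs_moebiusLogSum_sub_one_le`: `|M₁(u) - 1| ≤ C exp(-c√log u)` for `u ≥ 2`;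
  `exists_abs_moebiusLogSum_le`: `|M₁(u)| ≤ C₀` for all `u`; `tendsto_moebiusLogSum`: `M₁(u) → 1`.

## References

* B. Green, T. Tao, *The primes contain arbitrarily long arithmetic progressions*, Ann. of Math.
  167 (2008), 481–547, §10 (the estimate these sums feed). [cite: GreenTaoAnnals2008]
* H. L. Montgomery, R. C. Vaughan, *Multiplicative Number Theory I*, CUP 2007, §6.2 and §8.1
  (`∑ μ(n)/n`, `∑ μ(n) log n/n`). [cite: MontgomeryVaughan2007]
-/

noncomputable section

open Real MeasureTheory Set Filter Topology Finset
open scoped ArithmeticFunction.Moebius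

namespace Literature.NumberTheory.Sieve.GreenTao2008

/-! ### The two sums -/

/-- `m(t) = ∑_{1 ≤ n ≤ t} μ(n)/n`. [cite: MontgomeryVaughan2007, §8.1 (8.6)] -/
def moebiusHarmonic (t : ℝ) : ℝ := ∑ k ∈ Finset.Icc 1 ⌊t⌋₊, (μ k : ℝ) / k

/-- The logarithmic Riesz mean `M₁(u) = ∑_{1 ≤ n ≤ u} μ(n) log(u/n) / n`. [folklore] -/
def moebiusLogSum (u : ℝ) : ℝ := ∑ k ∈ Finset.Icc 1 ⌊u⌋₊, (μ k : ℝ) / k * Real.log (u / k)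

/-- Unfolding `m`. [folklore] -/
theorem moebiusHarmonic_def (t : ℝ) :
    moebiusHarmonic t = ∑ k ∈ Finset.Icc 1 ⌊t⌋₊, (μ k : ℝ) / k := rfl

/-- Unfolding `M₁`. [folklore] -/
theorem moebiusLogSum_def (u : ℝ) :
    moebiusLogSum u = ∑ k ∈ Finset.Icc 1 ⌊u⌋₊, (μ k : ℝ) / k * Real.log (u / k) := rfl

/-- `|μ(k)/k| ≤ 1`. [folklore] -/
theorem abs_moebius_div_le_one (k : ℕ) : |(μ k : ℝ) / k| ≤ 1 := by
  rcases Nat.eq_zero_or_pos k with rfl | hk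
  · simp
  · rw [abs_div, Nat.abs_cast, div_le_one (by exact_mod_cast hk)]
    calc |(μ k : ℝ)| ≤ 1 := by exact_mod_cast ArithmeticFunction.abs_moebius_le_one
      _ ≤ k := by exact_mod_cast hk

/-- The crude bound `|m(t)| ≤ t` (`t ≥ 0`): `⌊t⌋` terms of modulus `≤ 1`. [folklore] -/
theorem abs_moebiusHarmonic_le {t : ℝ} (ht : 0 ≤ t) : |moebiusHarmonic t| ≤ t := by
  unfold moebiusHarmonic
  calc |∑ k ∈ Finset.Icc 1 ⌊t⌋₊, (μ k : ℝ) / k| ≤ ∑ k ∈ Finset.Icc 1 ⌊t⌋₊, |(μ k : ℝ) / k| :=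
        Finset.abs_sum_le_sum_abs _ _
    _ ≤ ∑ k ∈ Finset.Icc 1 ⌊t⌋₊, (1 : ℝ) := Finset.sum_le_sum fun k _ => abs_moebius_div_le_one k
    _ = ⌊t⌋₊ := by simp
    _ ≤ t := Nat.floor_le ht

/-- `m` is measurable (it factors through `⌊t⌋`). [folklore] -/
theorem measurable_moebiusHarmonic : Measurable moebiusHarmonic :=
  (Measurable.of_discrete (f := fun n : ℕ => ∑ k ∈ Finset.Icc 1 n, (μ k : ℝ) / k)).comp
    Nat.measurable_floor

/-- `M₁(u) = 0` for `u < 1` (empty sum). [folklore] -/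
theorem moebiusLogSum_eq_zero_of_lt_one {u : ℝ} (hu : u < 1) : moebiusLogSum u = 0 := by
  unfold moebiusLogSum
  rcases lt_or_ge u 0 with h | h
  · rw [Nat.floor_of_nonpos h.le]; simp
  · rw [Nat.floor_eq_zero.2 hu]; simp

/-- The crude bound `|M₁(u)| ≤ u log u` for `u ≥ 1`. [folklore] -/
theorem abs_moebiusLogSum_le_mul_log {u : ℝ} (hu : 1 ≤ u) : |moebiusLogSum u| ≤ u * Real.log u := by
  unfold moebiusLogSum
  have hu0 : 0 < u := by linarith
  calc |∑ k ∈ Finset.Icc 1 ⌊u⌋₊, (μ k : ℝ) / k * Real.log (u / k)|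
      ≤ ∑ k ∈ Finset.Icc 1 ⌊u⌋₊, |(μ k : ℝ) / k * Real.log (u / k)| := Finset.abs_sum_le_sum_abs _ _
    _ ≤ ∑ k ∈ Finset.Icc 1 ⌊u⌋₊, Real.log u := Finset.sum_le_sum fun k hk => by
        have hk1 : (1 : ℝ) ≤ k := by exact_mod_cast (Finset.mem_Icc.1 hk).1
        have hku : (k : ℝ) ≤ u := (Nat.cast_le.2 (Finset.mem_Icc.1 hk).2).trans (Nat.floor_le hu0.le)
        have hlog0 : 0 ≤ Real.log (u / k) := Real.log_nonneg ((one_le_div (by linarith)).2 hku)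
        have hlog1 : Real.log (u / k) ≤ Real.log u := by
          rw [Real.log_div hu0.ne' (by linarith)]
          linarith [Real.log_nonneg hk1]
        rw [abs_mul, abs_of_nonneg hlog0]
        calc |(μ k : ℝ) / k| * Real.log (u / k) ≤ 1 * Real.log (u / k) :=
              mul_le_mul_of_nonneg_right (abs_moebius_div_le_one k) hlog0
          _ ≤ Real.log u := by rw [one_mul]; exact hlog1
    _ = ⌊u⌋₊ * Real.log u := by simp
    _ ≤ u * Real.log u := mul_le_mul_of_nonneg_right (Nat.floor_le hu0.le) (Real.log_nonneg hu)

/-! ### Abel summation: `M₁(u) = ∫_1^u m(t) dt/t` -/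

/-- **`M₁(u) = ∫_1^u m(t) dt/t`** for `u ≥ 1` (partial summation with `f(t) = log(u/t)`,
`f(u) = 0`, `f'(t) = -1/t`). [folklore] -/
theorem moebiusLogSum_eq_integral {u : ℝ} (hu : 1 ≤ u) :
    moebiusLogSum u = ∫ t in Set.Ioc 1 u, moebiusHarmonic t / t := by
  have hu0 : 0 < u := by linarith
  -- Abel summation with `f(t) = log u - log t`, `c(k) = μ(k)/k` on `[1, u]`
  set f : ℝ → ℝ := fun t => Real.log u - Real.log t with hf
  have hf_diff : ∀ t ∈ Set.Icc (1 : ℝ) u, DifferentiableAt ℝ f t := fun t ht =>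
    (differentiableAt_const _).sub (Real.differentiableAt_log (by linarith [ht.1]))
  have hderiv : deriv f = fun t => -t⁻¹ := by
    funext t
    rw [hf, deriv_const_sub, Real.deriv_log]
  have hf_int : IntegrableOn (deriv f) (Set.Icc (1 : ℝ) u) := by
    rw [hderiv]
    refine ContinuousOn.integrableOn_Icc (ContinuousOn.neg (ContinuousOn.inv₀ continuousOn_id ?_))
    intro t ht; exact (by linarith [ht.1] : t ≠ 0)
  have h := sum_mul_eq_sub_sub_integral_mul (fun k => (μ k : ℝ) / k) zero_le_one hu hf_diff hf_int
  rw [Nat.floor_one] at h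
  have h01 : ∑ k ∈ Finset.Icc 0 1, (μ k : ℝ) / k = 1 := by
    rw [show Finset.Icc 0 1 = {0, 1} from rfl, Finset.sum_pair (by norm_num)]
    simp
  have hfu : f u = 0 := by simp [hf]
  have hf1 : f 1 = Real.log u := by simp [hf]
  rw [h01, hfu, hf1, zero_mul, zero_sub, mul_one, hderiv] at h
  -- the partial sums `∑_{0 ≤ k ≤ ⌊t⌋} μ(k)/k` are `m(t)`
  have hS : ∀ t : ℝ, ∑ k ∈ Finset.Icc 0 ⌊t⌋₊, (μ k : ℝ) / k = moebiusHarmonic t := by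
    intro t
    rw [moebiusHarmonic, Finset.Icc_eq_cons_Ioc (Nat.zero_le _), Finset.sum_cons]
    simp only [ArithmeticFunction.map_zero, Int.cast_zero, Nat.cast_zero, div_zero, zero_add]
    rfl
  simp_rw [hS] at h
  have hint : ∫ t in Set.Ioc 1 u, (fun t : ℝ => -t⁻¹) t * moebiusHarmonic t =
      -∫ t in Set.Ioc 1 u, moebiusHarmonic t / t := by
    rw [← integral_neg]
    refine setIntegral_congr_fun measurableSet_Ioc fun t _ => ?_
    simp only [div_eq_mul_inv]
    ring
  rw [hint] at h
  -- `M₁(u) = f(1) c(1) + ∑_{1 < k ≤ u} f(k) c(k)`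
  have hsplit : moebiusLogSum u = Real.log u + ∑ k ∈ Finset.Ioc 1 ⌊u⌋₊, f k * ((μ k : ℝ) / k) := by
    rw [moebiusLogSum, Finset.Icc_eq_cons_Ioc (Nat.one_le_iff_ne_zero.mpr (Nat.floor_pos.mpr hu).ne'),
      Finset.sum_cons, ArithmeticFunction.moebius_apply_one]
    simp only [Int.cast_one, Nat.cast_one, div_one, one_mul]
    congr 1
    refine Finset.sum_congr rfl fun k hk => ?_
    have hk0 : (k : ℝ) ≠ 0 := by
      have : 1 < k := (Finset.mem_Ioc.1 hk).1
      exact_mod_cast (by omega : k ≠ 0)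
    rw [hf, Real.log_div hu0.ne' hk0]
    ring
  rw [hsplit, h]
  ring

/-! ### Integrability of `m(t)/t` on `(1, ∞)` and the tail -/

section FromBound

variable {c₀ C₀ : ℝ}

/-- Pointwise domination of `|m(t)/t|` by `6/t² + C₀ exp(-c₀√log t)/t` (`|m| ≤ t ≤ 2` on `(1,2]`,
the bound on `m` beyond). [folklore] -/
theorem abs_moebiusHarmonic_div_le (hC₀ : 0 ≤ C₀)
    (hmb : ∀ x : ℝ, 2 ≤ x → |moebiusHarmonic x| ≤ C₀ * Real.exp (-(c₀ * Real.sqrt (Real.log x))))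
    {t : ℝ} (ht : 1 < t) :
    |moebiusHarmonic t / t| ≤ 2 * (3 / t ^ 2) + C₀ * (Real.exp (-(c₀ * Real.sqrt (Real.log t))) / t) := by
  have ht0 : 0 < t := by linarith
  rw [abs_div, abs_of_pos ht0]
  rcases le_or_gt t 2 with h2 | h2
  · have hm : |moebiusHarmonic t| ≤ t := abs_moebiusHarmonic_le ht0.le
    have h3 : |moebiusHarmonic t| / t ≤ 2 * (3 / t ^ 2) := by
      rw [show 2 * (3 / t ^ 2) = 6 / t ^ 2 by ring, div_le_div_iff₀ ht0 (pow_pos ht0 2)]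
      have h4 : |moebiusHarmonic t| * t ^ 2 ≤ t * t ^ 2 :=
        mul_le_mul_of_nonneg_right hm (sq_nonneg t)
      nlinarith
    linarith [show 0 ≤ C₀ * (Real.exp (-(c₀ * Real.sqrt (Real.log t))) / t) by positivity]
  · calc |moebiusHarmonic t| / t ≤ C₀ * Real.exp (-(c₀ * Real.sqrt (Real.log t))) / t :=
          div_le_div_of_nonneg_right (hmb t h2.le) ht0.le
      _ = C₀ * (Real.exp (-(c₀ * Real.sqrt (Real.log t))) / t) := by ring
      _ ≤ _ := le_add_of_nonneg_left (by positivity)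

/-- **`m(t)/t` is integrable on `(1, ∞)`** under the bound `|m(x)| ≤ C₀ exp(-c₀√log x)` (`x ≥ 2`).
[folklore] -/
theorem integrableOn_moebiusHarmonic_div (hc₀ : 0 < c₀) (hC₀ : 0 ≤ C₀)
    (hmb : ∀ x : ℝ, 2 ≤ x → |moebiusHarmonic x| ≤ C₀ * Real.exp (-(c₀ * Real.sqrt (Real.log x)))) :
    IntegrableOn (fun t : ℝ => moebiusHarmonic t / t) (Set.Ioi 1) volume := by
  have hmeas : Measurable fun t : ℝ => moebiusHarmonic t / t :=
    measurable_moebiusHarmonic.div measurable_id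
  refine Integrable.mono'
    ((Literature.NumberTheory.LFunctions.MoebiusSum.integrableOn_three_div_sq.const_mul 2).add
    ((Literature.NumberTheory.LFunctions.MoebiusSum.integrableOn_exp_neg_mul_sqrt_log_div hc₀).const_mul C₀))
    hmeas.aestronglyMeasurable ?_
  refine ae_restrict_of_forall_mem measurableSet_Ioi fun t ht => ?_
  rw [Real.norm_eq_abs]
  exact abs_moebiusHarmonic_div_le hC₀ hmb ht

/-- **The tail**: for `x ≥ 2`, `∫_x^∞ |m(t)| dt/t ≤ C₀ K exp(-(c₀/2)√log x)` with
`K = ∫_1^∞ exp(-(c₀/2)√log t) dt/t`. [folklore] -/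
theorem integral_Ioi_abs_moebiusHarmonic_div_le (hc₀ : 0 < c₀) (hC₀ : 0 ≤ C₀)
    (hmb : ∀ x : ℝ, 2 ≤ x → |moebiusHarmonic x| ≤ C₀ * Real.exp (-(c₀ * Real.sqrt (Real.log x))))
    {x : ℝ} (hx : 2 ≤ x) :
    ∫ t in Set.Ioi x, |moebiusHarmonic t / t| ≤
      C₀ * (∫ t in Set.Ioi 1, Real.exp (-(c₀ / 2 * Real.sqrt (Real.log t))) / t) *
        Real.exp (-(c₀ / 2 * Real.sqrt (Real.log x))) := by
  have hx1 : 1 < x := by linarith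
  set K := ∫ t in Set.Ioi 1, Real.exp (-(c₀ / 2 * Real.sqrt (Real.log t))) / t with hK
  set Ex := Real.exp (-(c₀ / 2 * Real.sqrt (Real.log x))) with hEx
  have hsub : Set.Ioi x ⊆ Set.Ioi 1 := Set.Ioi_subset_Ioi hx1.le
  have hint : IntegrableOn (fun t : ℝ => moebiusHarmonic t / t) (Set.Ioi x) :=
    (integrableOn_moebiusHarmonic_div hc₀ hC₀ hmb).mono_set hsub
  have hdom : IntegrableOn (fun t : ℝ => Real.exp (-(c₀ / 2 * Real.sqrt (Real.log t))) / t)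
      (Set.Ioi 1) :=
    Literature.NumberTheory.LFunctions.MoebiusSum.integrableOn_exp_neg_mul_sqrt_log_div (half_pos hc₀)
  have hpt : ∀ t ∈ Set.Ioi x, |moebiusHarmonic t / t| ≤
      C₀ * Ex * (Real.exp (-(c₀ / 2 * Real.sqrt (Real.log t))) / t) := by
    intro t ht
    have ht2 : 2 ≤ t := hx.trans (le_of_lt ht)
    have ht0 : 0 < t := by linarith
    rw [abs_div, abs_of_pos ht0]
    have hexp : Real.exp (-(c₀ * Real.sqrt (Real.log t))) ≤
        Ex * Real.exp (-(c₀ / 2 * Real.sqrt (Real.log t))) := by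
      rw [hEx, ← Real.exp_add]
      have hsqrt : Real.sqrt (Real.log x) ≤ Real.sqrt (Real.log t) :=
        Real.sqrt_le_sqrt (Real.log_le_log (by linarith) ht.le)
      exact Real.exp_le_exp.2 (by nlinarith [hc₀.le])
    calc |moebiusHarmonic t| / t ≤ C₀ * Real.exp (-(c₀ * Real.sqrt (Real.log t))) / t :=
          div_le_div_of_nonneg_right (hmb t ht2) ht0.le
      _ ≤ C₀ * (Ex * Real.exp (-(c₀ / 2 * Real.sqrt (Real.log t)))) / t := by gcongr
      _ = C₀ * Ex * (Real.exp (-(c₀ / 2 * Real.sqrt (Real.log t))) / t) := by ring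
  calc ∫ t in Set.Ioi x, |moebiusHarmonic t / t|
      ≤ ∫ t in Set.Ioi x, C₀ * Ex * (Real.exp (-(c₀ / 2 * Real.sqrt (Real.log t))) / t) :=
        setIntegral_mono_on hint.abs ((hdom.mono_set hsub).const_mul _) measurableSet_Ioi hpt
    _ = C₀ * Ex * ∫ t in Set.Ioi x, Real.exp (-(c₀ / 2 * Real.sqrt (Real.log t))) / t := by
        rw [integral_const_mul]
    _ ≤ C₀ * Ex * K := by
        refine mul_le_mul_of_nonneg_left ?_ (by positivity)
        refine setIntegral_mono_set hdom ?_ hsub.eventuallyLE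
        exact ae_restrict_of_forall_mem measurableSet_Ioi fun t ht =>
          div_nonneg (Real.exp_pos _).le (zero_le_one.trans ht.le)
    _ = C₀ * K * Ex := by ring

end FromBound

/-! ### `∫_1^∞ m(t) dt/t = 1`: the Abelian argument through `L(μ/id, δ) = 1/ζ(1+δ)` -/

section LimitOne

/-- **`1/ζ(1+δ) = δ ∫_1^∞ m(t) t^{-1-δ} dt`** for `δ > 0`: Mathlib's integral representation
`L(f, s) = s ∫_1^∞ (∑_{k ≤ t} f(k)) t^{-s-1} dt` for `f(n) = μ(n)/n` (bounded partial sums) at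
`s = δ`, and `L(μ/id, δ) = L(μ, 1+δ) = 1/ζ(1+δ)`. [folklore] -/
theorem inv_riemannZeta_eq_mul_integral_moebiusHarmonic {B : ℝ} (hB : ∀ n : ℕ, |moebiusHarmonic n| ≤ B)
    {δ : ℝ} (hδ : 0 < δ) :
    (riemannZeta ((1 + δ : ℝ) : ℂ))⁻¹ =
      ((δ : ℝ) : ℂ) * ((∫ t in Set.Ioi 1, moebiusHarmonic t * t ^ (-(1 + δ)) : ℝ) : ℂ) := by
  set f : ℕ → ℂ := fun n => (μ n : ℂ) / n with hf
  set s : ℂ := ((δ : ℝ) : ℂ) with hs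
  have hsre : 0 < s.re := by rw [hs, Complex.ofReal_re]; exact hδ
  have h1δ : 1 < (1 + s).re := by simp [hs, hδ]
  -- termwise: `term f s n = term μ (1 + s) n`
  have hterm : ∀ n : ℕ, LSeries.term f s n = LSeries.term (fun n : ℕ => (μ n : ℂ)) (1 + s) n := by
    intro n
    rcases Nat.eq_zero_or_pos n with rfl | hn
    · simp [LSeries.term]
    · have hn0 : (n : ℂ) ≠ 0 := by exact_mod_cast hn.ne'
      rw [LSeries.term_of_ne_zero hn.ne', LSeries.term_of_ne_zero hn.ne', hf]
      simp only
      rw [Complex.cpow_add _ _ hn0, Complex.cpow_one, div_div]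
  have hμ : LSeries (fun n : ℕ => (μ n : ℂ)) (1 + s) = (riemannZeta (1 + s))⁻¹ := by
    have h := LSeries_one_mul_Lseries_moebius h1δ
    rw [LSeries_one_eq_riemannZeta h1δ] at h
    exact eq_inv_of_mul_eq_one_right h
  have hLf : LSeries f s = (riemannZeta (1 + s))⁻¹ := by
    rw [← hμ, LSeries, LSeries]
    exact tsum_congr hterm
  have hS : LSeriesSummable f s := by
    have h2 : LSeriesSummable (fun n : ℕ => (μ n : ℂ)) (1 + s) :=
      LSeriesSummable_of_bounded_of_one_lt_re (m := 1) (fun n _ => by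
        rw [Complex.norm_intCast]; exact_mod_cast ArithmeticFunction.abs_moebius_le_one) h1δ
    unfold LSeriesSummable at h2 ⊢
    exact (summable_congr hterm).2 h2
  -- partial sums of `f` are the (bounded) `m(n)`
  have hpartial : ∀ n : ℕ, ∑ k ∈ Finset.Icc 1 n, f k = ((moebiusHarmonic n : ℝ) : ℂ) := by
    intro n
    rw [moebiusHarmonic, Nat.floor_natCast, Complex.ofReal_sum]
    refine Finset.sum_congr rfl fun k _ => ?_
    rw [hf]; push_cast; rfl
  have hO : (fun n : ℕ => ∑ k ∈ Finset.Icc 1 n, f k) =O[atTop] fun n => (n : ℝ) ^ (0 : ℝ) := by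
    refine Asymptotics.IsBigO.of_bound |B| (Filter.Eventually.of_forall fun n => ?_)
    rw [hpartial, Complex.norm_real, Real.norm_eq_abs, Real.rpow_zero, Real.norm_eq_abs, abs_one,
      mul_one]
    exact (hB n).trans (le_abs_self B)
  have hint := LSeries_eq_mul_integral f le_rfl hsre hS hO
  rw [hLf] at hint
  have h1s : (1 : ℂ) + s = ((1 + δ : ℝ) : ℂ) := by rw [hs]; push_cast; ring
  rw [h1s] at hint
  rw [hint]
  congr 1
  rw [show (((∫ t in Set.Ioi 1, moebiusHarmonic t * t ^ (-(1 + δ)) : ℝ)) : ℂ) =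
      ∫ t in Set.Ioi 1, ((moebiusHarmonic t * t ^ (-(1 + δ)) : ℝ) : ℂ) from integral_ofReal.symm]
  refine setIntegral_congr_fun measurableSet_Ioi fun t ht => ?_
  have ht0 : 0 < t := zero_lt_one.trans ht
  have h2 : (t : ℂ) ^ (-(s + 1)) = ((t ^ (-(1 + δ)) : ℝ) : ℂ) := by
    rw [Complex.ofReal_cpow ht0.le]
    congr 1
    rw [hs]; push_cast; ring
  have h3 : ∑ k ∈ Finset.Icc 1 ⌊t⌋₊, f k = ((moebiusHarmonic t : ℝ) : ℂ) := by
    rw [hpartial ⌊t⌋₊]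
    simp only [moebiusHarmonic, Nat.floor_natCast]
  rw [h3, h2]
  push_cast
  ring

/-- `(δ ζ(1+δ))⁻¹ → 1` as `δ → 0⁺` (the simple pole of `ζ` at `1` with residue `1`).
[folklore] -/
theorem tendsto_inv_mul_riemannZeta_one_add :
    Tendsto (fun δ : ℝ => (((δ : ℝ) : ℂ) * riemannZeta ((1 + δ : ℝ) : ℂ))⁻¹) (𝓝[>] 0) (𝓝 1) := by
  have hsδ : Tendsto (fun δ : ℝ => ((1 + δ : ℝ) : ℂ)) (𝓝[>] 0) (𝓝[≠] 1) := by
    refine tendsto_nhdsWithin_of_tendsto_nhds_of_eventually_within _ ?_ ?_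
    · have : Continuous fun δ : ℝ => ((1 + δ : ℝ) : ℂ) := by fun_prop
      simpa using (this.tendsto 0).mono_left nhdsWithin_le_nhds
    · filter_upwards [self_mem_nhdsWithin] with δ hδ
      simp only [Set.mem_compl_iff, Set.mem_singleton_iff]
      intro h
      have := congrArg Complex.re h
      simp at this
      exact (ne_of_gt (Set.mem_Ioi.mp hδ)) this
  have hres := riemannZeta_residue_one.comp hsδ
  have hres' := hres.inv₀ one_ne_zero
  rw [inv_one] at hres'
  refine hres'.congr' ?_
  filter_upwards [self_mem_nhdsWithin] with δ _
  simp only [Function.comp_apply]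
  congr 2
  push_cast; ring

variable {c₀ C₀ : ℝ}

/-- **`∫_1^∞ m(t) dt/t = 1`** under the bound `|m(x)| ≤ C₀ exp(-c₀√log x)` (`x ≥ 2`): the
integrals `∫_1^∞ m(t) t^{-1-δ} dt = (δ ζ(1+δ))⁻¹` tend to it as `δ → 0⁺` (dominated convergence)
and to `1` (pole of `ζ`). [folklore] -/
theorem integral_moebiusHarmonic_div_eq_one_of_bound (hc₀ : 0 < c₀) (hC₀ : 0 ≤ C₀)
    (hmb : ∀ x : ℝ, 2 ≤ x → |moebiusHarmonic x| ≤ C₀ * Real.exp (-(c₀ * Real.sqrt (Real.log x)))) :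
    ∫ t in Set.Ioi 1, moebiusHarmonic t / t = 1 := by
  set L : ℝ := ∫ t in Set.Ioi 1, moebiusHarmonic t / t with hL
  have hLint : IntegrableOn (fun t : ℝ => moebiusHarmonic t / t) (Set.Ioi 1) :=
    integrableOn_moebiusHarmonic_div hc₀ hC₀ hmb
  -- a uniform bound for `m` at the integers
  have hB : ∀ n : ℕ, |moebiusHarmonic n| ≤ max 2 C₀ := by
    intro n
    rcases le_or_gt (2 : ℝ) n with h2 | h2
    · calc |moebiusHarmonic n| ≤ C₀ * Real.exp (-(c₀ * Real.sqrt (Real.log n))) := hmb n h2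
        _ ≤ C₀ * 1 := mul_le_mul_of_nonneg_left
            (Real.exp_le_one_iff.2 (neg_nonpos.2 (by positivity))) hC₀
        _ ≤ max 2 C₀ := by rw [mul_one]; exact le_max_right _ _
    · calc |moebiusHarmonic n| ≤ n := abs_moebiusHarmonic_le (Nat.cast_nonneg n)
        _ ≤ 2 := h2.le
        _ ≤ max 2 C₀ := le_max_left _ _
  -- dominated convergence: `∫ m t^{-1-δ} → ∫ m/t = L` as `δ → 0⁺`
  have hDCT : Tendsto (fun δ : ℝ => ∫ t in Set.Ioi 1, moebiusHarmonic t * t ^ (-(1 + δ))) (𝓝[>] 0)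
      (𝓝 L) := by
    have hL' : L = ∫ t in Set.Ioi 1, moebiusHarmonic t * t ^ (-(1 + (0 : ℝ))) := by
      rw [hL]
      refine setIntegral_congr_fun measurableSet_Ioi fun t ht => ?_
      have ht0 : 0 < t := zero_lt_one.trans ht
      simp only [add_zero]
      rw [Real.rpow_neg ht0.le, Real.rpow_one, div_eq_mul_inv]
    rw [hL']
    refine tendsto_integral_filter_of_dominated_convergence (fun t => |moebiusHarmonic t / t|) ?_ ?_
      hLint.abs ?_
    · filter_upwards [self_mem_nhdsWithin] with δ _
      exact (measurable_moebiusHarmonic.mul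
        (measurable_id.pow_const _)).aestronglyMeasurable
    · filter_upwards [self_mem_nhdsWithin] with δ hδ
      have hδ0 : 0 < δ := Set.mem_Ioi.mp hδ
      refine ae_restrict_of_forall_mem measurableSet_Ioi fun t ht => ?_
      have ht0 : 0 < t := zero_lt_one.trans ht
      rw [Real.norm_eq_abs, abs_mul, abs_div, abs_of_pos ht0,
        abs_of_pos (Real.rpow_pos_of_pos ht0 _), div_eq_mul_inv]
      refine mul_le_mul_of_nonneg_left ?_ (abs_nonneg _)
      rw [← Real.rpow_neg_one, ]
      exact Real.rpow_le_rpow_of_exponent_le ht.le (by linarith)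
    · refine ae_restrict_of_forall_mem measurableSet_Ioi fun t ht => ?_
      have ht0 : 0 < t := zero_lt_one.trans ht
      refine Tendsto.const_mul _ ?_
      have hcont : Continuous fun δ : ℝ => t ^ (-(1 + δ)) :=
        (Real.continuous_const_rpow ht0.ne').comp (by fun_prop)
      exact (hcont.tendsto 0).mono_left nhdsWithin_le_nhds
  -- the same integrals through `ζ`: `∫ … = (δ ζ(1+δ))⁻¹ → 1`
  have hC : Tendsto (fun δ : ℝ => (((∫ t in Set.Ioi 1, moebiusHarmonic t * t ^ (-(1 + δ)) : ℝ)) : ℂ))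
      (𝓝[>] 0) (𝓝 (L : ℂ)) :=
    (Complex.continuous_ofReal.tendsto L).comp hDCT
  have hC' : Tendsto (fun δ : ℝ => (((∫ t in Set.Ioi 1, moebiusHarmonic t * t ^ (-(1 + δ)) : ℝ)) : ℂ))
      (𝓝[>] 0) (𝓝 1) := by
    refine tendsto_inv_mul_riemannZeta_one_add.congr' ?_
    filter_upwards [self_mem_nhdsWithin] with δ hδ
    have hδ0 : 0 < δ := Set.mem_Ioi.mp hδ
    have h := inv_riemannZeta_eq_mul_integral_moebiusHarmonic hB hδ0
    have hδne : ((δ : ℝ) : ℂ) ≠ 0 := by exact_mod_cast hδ0.ne'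
    have hζne : riemannZeta ((1 + δ : ℝ) : ℂ) ≠ 0 := by
      refine riemannZeta_ne_zero_of_one_lt_re ?_
      simp [hδ0]
    rw [mul_inv, h, ← mul_assoc, inv_mul_cancel₀ hδne, one_mul]
  have huniq := tendsto_nhds_unique hC hC'
  exact_mod_cast huniq

end LimitOne

/-! ### Unconditional statements -/

/-- The tree's bound `|m(x)| ≤ C exp(-c√log x)` (`x ≥ 2`) with a nonnegative constant.
[cite: MontgomeryVaughan2007, Theorem 6.9 (6.12)] -/
theorem exists_abs_moebiusHarmonic_le :
    ∃ c₀ : ℝ, 0 < c₀ ∧ ∃ C₀ : ℝ, 0 ≤ C₀ ∧ ∀ x : ℝ, 2 ≤ x →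
      |moebiusHarmonic x| ≤ C₀ * Real.exp (-(c₀ * Real.sqrt (Real.log x))) := by
  obtain ⟨c, hc, C, h⟩ := Literature.NumberTheory.LFunctions.abs_sum_moebius_div_le_exp_neg_sqrt_log
  refine ⟨c, hc, max C 0, le_max_right _ _, fun x hx => ?_⟩
  rw [moebiusHarmonic]
  refine (h x hx).trans ?_
  rw [neg_mul]
  exact mul_le_mul_of_nonneg_right (le_max_left _ _) (Real.exp_pos _).le

/-- **`∫_1^∞ m(t) dt/t = 1`**, unconditionally. [folklore] -/
theorem integral_moebiusHarmonic_div_eq_one : ∫ t in Set.Ioi 1, moebiusHarmonic t / t = 1 := by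
  obtain ⟨c₀, hc₀, C₀, hC₀, hmb⟩ := exists_abs_moebiusHarmonic_le
  exact integral_moebiusHarmonic_div_eq_one_of_bound hc₀ hC₀ hmb

/-- **`M₁(u) = 1 + O(exp(-c√log u))`**: there are `c > 0` and `C` with
`|∑_{n ≤ u} μ(n) log(u/n)/n - 1| ≤ C exp(-c√log u)` for `u ≥ 2`. (Equivalent, by partial summation,
to `∑ μ(n)/n = 0` together with `∑ μ(n) log n/n = -1`; Landau.) [cite: MontgomeryVaughan2007, §8.1] -/
theorem exists_abs_moebiusLogSum_sub_one_le :
    ∃ c : ℝ, 0 < c ∧ ∃ C : ℝ, 0 ≤ C ∧ ∀ u : ℝ, 2 ≤ u →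
      |moebiusLogSum u - 1| ≤ C * Real.exp (-(c * Real.sqrt (Real.log u))) := by
  obtain ⟨c₀, hc₀, C₀, hC₀, hmb⟩ := exists_abs_moebiusHarmonic_le
  set K := ∫ t in Set.Ioi 1, Real.exp (-(c₀ / 2 * Real.sqrt (Real.log t))) / t with hK
  have hK0 : 0 ≤ K := setIntegral_nonneg measurableSet_Ioi fun t ht =>
    div_nonneg (Real.exp_pos _).le (zero_le_one.trans ht.le)
  refine ⟨c₀ / 2, half_pos hc₀, C₀ * K, mul_nonneg hC₀ hK0, fun u hu => ?_⟩
  have hu1 : 1 ≤ u := by linarith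
  have hLint := integrableOn_moebiusHarmonic_div hc₀ hC₀ hmb
  -- `M₁(u) - 1 = ∫_1^u - ∫_1^∞ = -∫_u^∞`
  have hsplit : moebiusLogSum u - 1 = -∫ t in Set.Ioi u, moebiusHarmonic t / t := by
    have hone := integral_moebiusHarmonic_div_eq_one_of_bound hc₀ hC₀ hmb
    rw [moebiusLogSum_eq_integral hu1]
    have hunion : Set.Ioc 1 u ∪ Set.Ioi u = Set.Ioi 1 := Set.Ioc_union_Ioi_eq_Ioi hu1
    have hdisj : Disjoint (Set.Ioc 1 u) (Set.Ioi u) := fun s hs1 hs2 t ht =>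
      absurd (lt_of_lt_of_le (Set.mem_Ioi.mp (hs2 ht)) (Set.mem_Ioc.mp (hs1 ht)).2) (lt_irrefl _)
    have h := setIntegral_union hdisj measurableSet_Ioi (hLint.mono_set Set.Ioc_subset_Ioi_self)
      (hLint.mono_set (Set.Ioi_subset_Ioi hu1))
    rw [hunion] at h
    linarith
  rw [hsplit, abs_neg]
  calc |∫ t in Set.Ioi u, moebiusHarmonic t / t| ≤ ∫ t in Set.Ioi u, |moebiusHarmonic t / t| :=
        abs_integral_le_integral_abs
    _ ≤ C₀ * K * Real.exp (-(c₀ / 2 * Real.sqrt (Real.log u))) :=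
        integral_Ioi_abs_moebiusHarmonic_div_le hc₀ hC₀ hmb hu

/-- **`sup_u |M₁(u)| < ∞`**: there is `C₀` with `|∑_{n ≤ u} μ(n) log(u/n)/n| ≤ C₀` for every real `u`.
[folklore] -/
theorem exists_abs_moebiusLogSum_le : ∃ C₀ : ℝ, 0 ≤ C₀ ∧ ∀ u : ℝ, |moebiusLogSum u| ≤ C₀ := by
  obtain ⟨c, _, C, hC, h⟩ := exists_abs_moebiusLogSum_sub_one_le
  refine ⟨max (1 + C) (2 * Real.log 2), le_max_of_le_left (by linarith), fun u => ?_⟩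
  rcases lt_or_ge u 1 with h1 | h1
  · rw [moebiusLogSum_eq_zero_of_lt_one h1, abs_zero]; positivity
  rcases lt_or_ge u 2 with h2 | h2
  · refine le_max_of_le_right ((abs_moebiusLogSum_le_mul_log h1).trans ?_)
    have : Real.log u ≤ Real.log 2 := Real.log_le_log (by linarith) h2.le
    have : 0 ≤ Real.log u := Real.log_nonneg h1
    nlinarith
  · refine le_max_of_le_left ?_
    have hle := h u h2
    have hexp : C * Real.exp (-(c * Real.sqrt (Real.log u))) ≤ C := by
      calc C * Real.exp (-(c * Real.sqrt (Real.log u))) ≤ C * 1 :=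
            mul_le_mul_of_nonneg_left (Real.exp_le_one_iff.2 (neg_nonpos.2 (by positivity))) hC
        _ = C := mul_one C
    calc |moebiusLogSum u| = |1 + (moebiusLogSum u - 1)| := by ring_nf
      _ ≤ |(1 : ℝ)| + |moebiusLogSum u - 1| := abs_add_le _ _
      _ ≤ 1 + C := by rw [abs_one]; linarith

/-- **`M₁(u) → 1`** as `u → ∞`. [cite: MontgomeryVaughan2007, §8.1] -/
theorem tendsto_moebiusLogSum : Tendsto moebiusLogSum atTop (𝓝 1) := by
  obtain ⟨c, hc, C, _, h⟩ := exists_abs_moebiusLogSum_sub_one_le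
  have hlim : Tendsto (fun u : ℝ => C * Real.exp (-(c * Real.sqrt (Real.log u)))) atTop (𝓝 (C * 0)) := by
    refine Tendsto.const_mul C (Real.tendsto_exp_atBot.comp ?_)
    have h1 : Tendsto (fun u : ℝ => c * Real.sqrt (Real.log u)) atTop atTop :=
      (Real.tendsto_sqrt_atTop.comp Real.tendsto_log_atTop).const_mul_atTop hc
    exact tendsto_neg_atTop_atBot.comp h1
  rw [mul_zero] at hlim
  refine tendsto_sub_nhds_zero_iff.1 (squeeze_zero_norm' ?_ hlim)
  filter_upwards [eventually_ge_atTop 2] with u hu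
  rw [Real.norm_eq_abs]
  exact h u hu

end Literature.NumberTheory.Sieve.GreenTao2008
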